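import Literature.LinearAlgebra.Matrix.SimultaneousTriangularization
import Summits.ValiantsHypothesis.ValiantsHypothesis.Theorems.GrenetZeonDualUnipotentThreeHalvesLongMassTriangular

/-!
# `GrenetZeon.DualUnipotentThreeHalves` (stmt-ValiantsHypothesis-24318), line `slow_core`, stub (c) `SlowCore.LongMassSlowLawInv`:
# THE ENGEL ROW — a LIE-CLOSED nil space is simultaneously strictly triangularisable, hence (c)-cheap with `c = 3`

The triangularisable row (✓ `TriangularRow.relCert_of_valueSpace_triangularisable`, `c = 3`) prices every pencil whose values lie in ONE
simultaneously strictly-upper-triangularisable space.  This file supplies the classical SOURCE of such spaces by name: ENGEL'S THEOREM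
(Mathlib `LieModule.isNilpotent_iff_forall'`) — a linear space `V ≤ M_b(ℂ)` of nilpotent matrices closed under the commutator
`[A, B] = AB − BA` (in particular: closed under products — a nil ALGEBRA; or COMMUTATIVE) is strictly upper triangular in one constant basis.
Road: Engel makes `ℂ^b` a nilpotent Lie module over `V`, whose lower central series `ℂ^b = F₀ ⊇ F₁ ⊇ ⋯ ⊇ F_s = 0` is LOWERED by every
`A ∈ V` (`A·F_i ⊆ F_{i+1}`); every noncommutative polynomial `p(A_1, …)` PRESERVES the flag, so `p(A)·[A_k, A_ℓ]` lowers it and is nilpotent —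
McCoy's criterion (a) (tree: `Literature.….SimultaneousTriangularization.forall_isNilpotent_iff_exists_isUnit`, Horn–Johnson Thm. 2.4.8.7
+ 2.4.8.6) gives ONE nonsingular `S` with every `S⁻¹ A S` upper triangular, and nilpotent upper triangular matrices have zero diagonal.

* §1 flag calculus: `pow_mulVec_mem_of_lowers`, `pow_eq_zero_of_lowers`, `lift_mulVec_mem_of_lowers` (nc polynomials preserve a lowered flag),
  `isNilpotent_lift_mul_comm_of_lowers` (McCoy (a) from a lowered flag).
* §2 ★★ `exists_flag_of_lieClosed` — ENGEL: a Lie-closed nil space lowers a finite flag `⊤ = F₀ ⊇ ⋯ ⊇ F_s = ⊥`.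
* §3 ★★★ `exists_unit_conj_strictUpper_of_lieClosed` — a Lie-closed nil space is simultaneously STRICTLY upper triangularisable by one unit `P`
  (`(P A P⁻¹)_{ij} = 0` for `j ≤ i`); corollaries `…_of_mulClosed` (nil algebras), `…_of_commute` (commutative nil spaces).
* §4 ★★ THE ENGEL ROW `relCert_of_valueSpace_lieClosed` — an affine pencil whose values lie in a Lie-closed nil space has
  `RelCert n m N (3·(⌊√n⌋·m))`, i.e. (c)'s conclusion with `c = 3`, `n₀ = 0`; `relCert_of_valueSpace_mulClosed`, `relCert_of_valueSpace_commute`;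
  `longMass_on_lieClosed_locus` in the binder shape of the stub.  So a (c)-violator's value space is NOT closed under the commutator: the
  enemy Q-RED-2 is non-Lie as well as non-triangularisable (of course Lie-closed ⊂ triangularisable; the point is the by-name source).

HONEST FRAMING.  Calibration row (`--supports stmt-ValiantsHypothesis-24318`), classical (Engel 1893 / Jacobson; McCoy 1936 via Horn–Johnson
§2.4.8); NOT progress on the research stub (c) `SlowCore.LongMassSlowLawInv` (irreducible constituents of size `b ≥ 2` are never triangularisable);
closes no stub; S3, 24318, 8062 and `VP ≠ VNP` are NOT proved.  Def-free, no named-fact hypotheses, no sorry.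
[cite: HornJohnson2013, Thm. 2.4.8.7 (p0162–0163)]
-/

set_option linter.dupNamespace false
set_option autoImplicit false

noncomputable section

namespace Summit.ValiantsHypothesis.ValiantsHypothesis.Theorems.GrenetZeon.NilSpaceEngel

open Matrix
open scoped BigOperators
open Summit.ValiantsHypothesis.ValiantsHypothesis.Cruxes.TwoDimCoefficients.DimTwoCases (AffMat IsAffine)
open Summit.ValiantsHypothesis.ValiantsHypothesis.Theorems.GrenetZeon.SlowCore (RelCert)
open Summit.ValiantsHypothesis.ValiantsHypothesis.Theorems.GrenetZeon.TriangularRow (relCert_of_valueSpace_triangularisable)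

variable {b : ℕ}

/-! ## §1 Flag calculus: a matrix LOWERS the chain `F` if `A·F_i ⊆ F_{i+1}`, PRESERVES it if `A·F_i ⊆ F_i` -/

/-- Powers of a lowering matrix lower by the exponent: `X^k · F_i ⊆ F_{i+k}`. -/
theorem pow_mulVec_mem_of_lowers (F : ℕ → Submodule ℂ (Fin b → ℂ)) (X : Matrix (Fin b) (Fin b) ℂ)
    (hX : ∀ i, ∀ v ∈ F i, X *ᵥ v ∈ F (i + 1)) :
    ∀ (k i : ℕ), ∀ v ∈ F i, X ^ k *ᵥ v ∈ F (i + k)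
  | 0, i, v, hv => by simpa using hv
  | k + 1, i, v, hv => by
    rw [pow_succ, ← Matrix.mulVec_mulVec]
    have h := pow_mulVec_mem_of_lowers F X hX k (i + 1) (X *ᵥ v) (hX i v hv)
    rwa [add_assoc, add_comm 1 k] at h

/-- A matrix lowering a finite chain `⊤ = F₀ ⊇ ⋯`, `F_s = ⊥` satisfies `X^s = 0`. -/
theorem pow_eq_zero_of_lowers (F : ℕ → Submodule ℂ (Fin b → ℂ)) (hF0 : F 0 = ⊤) {s : ℕ} (hFs : F s = ⊥)
    (X : Matrix (Fin b) (Fin b) ℂ) (hX : ∀ i, ∀ v ∈ F i, X *ᵥ v ∈ F (i + 1)) : X ^ s = 0 := by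
  have hall : ∀ v : Fin b → ℂ, X ^ s *ᵥ v = 0 := by
    intro v
    have h := pow_mulVec_mem_of_lowers F X hX s 0 v (by rw [hF0]; exact Submodule.mem_top)
    rwa [zero_add, hFs, Submodule.mem_bot] at h
  ext i j
  have := congr_fun (hall (Pi.single j 1)) i
  rw [Matrix.mulVec_single_one] at this
  rw [Matrix.zero_apply]
  simpa using this

/-- Noncommutative polynomials in lowering matrices PRESERVE a descending chain. -/
theorem lift_mulVec_mem_of_lowers (F : ℕ → Submodule ℂ (Fin b → ℂ)) (hanti : ∀ i, F (i + 1) ≤ F i)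
    {ι : Type*} (A : ι → Matrix (Fin b) (Fin b) ℂ) (hA : ∀ k i, ∀ v ∈ F i, A k *ᵥ v ∈ F (i + 1))
    (p : FreeAlgebra ℂ ι) : ∀ i, ∀ v ∈ F i, FreeAlgebra.lift ℂ A p *ᵥ v ∈ F i := by
  induction p with
  | grade0 r =>
    intro i v hv
    rw [AlgHom.commutes, Algebra.algebraMap_eq_smul_one, Matrix.smul_mulVec, Matrix.one_mulVec]
    exact (F i).smul_mem r hv
  | grade1 k =>
    intro i v hv
    rw [FreeAlgebra.lift_ι_apply]
    exact hanti i (hA k i v hv)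
  | mul a c ha hc =>
    intro i v hv
    rw [map_mul, ← Matrix.mulVec_mulVec]
    exact ha i _ (hc i v hv)
  | add a c ha hc =>
    intro i v hv
    rw [map_add, Matrix.add_mulVec]
    exact (F i).add_mem (ha i v hv) (hc i v hv)

/-- **McCoy's criterion (a) from a lowered flag.**  If the family `A` lowers a finite descending chain `⊤ = F₀ ⊇ ⋯ ⊇ F_s = ⊥` and the chain is
also lowered by the commutator `A_k A_ℓ − A_ℓ A_k`, then `p(A)·(A_k A_ℓ − A_ℓ A_k)` is nilpotent for every noncommutative polynomial `p`.
[cite: HornJohnson2013, Thm. 2.4.8.7 (a) (p0162)] -/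
theorem isNilpotent_lift_mul_comm_of_lowers (F : ℕ → Submodule ℂ (Fin b → ℂ)) (hF0 : F 0 = ⊤) {s : ℕ} (hFs : F s = ⊥)
    (hanti : ∀ i, F (i + 1) ≤ F i) {ι : Type*} (A : ι → Matrix (Fin b) (Fin b) ℂ)
    (hA : ∀ k i, ∀ v ∈ F i, A k *ᵥ v ∈ F (i + 1)) (k l : ι)
    (hkl : ∀ i, ∀ v ∈ F i, (A k * A l - A l * A k) *ᵥ v ∈ F (i + 1)) (p : FreeAlgebra ℂ ι) :
    IsNilpotent (FreeAlgebra.lift ℂ A p * (A k * A l - A l * A k)) := by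
  refine ⟨s, pow_eq_zero_of_lowers F hF0 hFs _ fun i v hv => ?_⟩
  rw [← Matrix.mulVec_mulVec]
  exact lift_mulVec_mem_of_lowers F hanti A hA p (i + 1) _ (hkl i v hv)

/-! ## §2 Engel's theorem: a Lie-closed nil space lowers a finite flag -/

/-- ★★ **ENGEL (flag form).**  A linear space `V ≤ M_b(ℂ)` of nilpotent matrices closed under the commutator lowers a finite descending chain of
subspaces `ℂ^b = F₀ ⊇ F₁ ⊇ ⋯ ⊇ F_s = 0` (`A·F_i ⊆ F_{i+1}` for all `A ∈ V`): the lower central series of `ℂ^b` as a Lie module over `V`,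
nilpotent by Mathlib's Engel theorem `LieModule.isNilpotent_iff_forall'`. [folklore] -/
theorem exists_flag_of_lieClosed (V : Submodule ℂ (Matrix (Fin b) (Fin b) ℂ)) (hnil : ∀ A ∈ V, IsNilpotent A)
    (hlie : ∀ A ∈ V, ∀ B ∈ V, A * B - B * A ∈ V) :
    ∃ F : ℕ → Submodule ℂ (Fin b → ℂ), F 0 = ⊤ ∧ (∃ s, F s = ⊥) ∧ (∀ i, F (i + 1) ≤ F i) ∧
      ∀ A ∈ V, ∀ i, ∀ v ∈ F i, A *ᵥ v ∈ F (i + 1) := by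
  letI : LieRing (Module.End ℂ (Fin b → ℂ)) := LieRing.ofAssociativeRing
  letI : LieAlgebra ℂ (Module.End ℂ (Fin b → ℂ)) := LieAlgebra.ofAssociativeAlgebra
  set φ : Matrix (Fin b) (Fin b) ℂ ≃ₐ[ℂ] Module.End ℂ (Fin b → ℂ) := Matrix.toLinAlgEquiv' with hφ
  set N : Submodule ℂ (Module.End ℂ (Fin b → ℂ)) := V.map (φ : Matrix (Fin b) (Fin b) ℂ →ₗ[ℂ] Module.End ℂ (Fin b → ℂ))
    with hN
  have hmemN : ∀ {X : Module.End ℂ (Fin b → ℂ)}, X ∈ N → ∃ A ∈ V, φ A = X := fun hX => by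
    obtain ⟨A, hA, hAX⟩ := Submodule.mem_map.mp hX
    exact ⟨A, hA, hAX⟩
  have hNmem : ∀ A ∈ V, φ A ∈ N := fun A hA => Submodule.mem_map.mpr ⟨A, hA, rfl⟩
  let L : LieSubalgebra ℂ (Module.End ℂ (Fin b → ℂ)) :=
    { N with
      lie_mem' := fun {X Y} hX hY => by
        obtain ⟨A, hA, rfl⟩ := hmemN hX
        obtain ⟨B, hB, rfl⟩ := hmemN hY
        rw [LieRing.of_associative_ring_bracket]
        have h := hNmem _ (hlie A hA B hB)
        rwa [map_sub, map_mul, map_mul] at h }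
  have hL : ∀ x : L, _root_.IsNilpotent (LieModule.toEnd ℂ L (Fin b → ℂ) x) := fun x => by
    rw [LieSubalgebra.toEnd_eq, LieModule.toEnd_module_end, LieHom.id_apply]
    obtain ⟨A, hA, hAx⟩ := hmemN x.2
    rw [← hAx]
    exact (hnil A hA).map φ
  haveI : LieModule.IsNilpotent L (Fin b → ℂ) := (LieModule.isNilpotent_iff_forall' (R := ℂ)).mpr hL
  obtain ⟨s, hs⟩ := LieModule.IsNilpotent.nilpotent ℂ L (Fin b → ℂ)
  refine ⟨fun i => ((LieModule.lowerCentralSeries ℂ L (Fin b → ℂ) i : LieSubmodule ℂ L (Fin b → ℂ)) :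
      Submodule ℂ (Fin b → ℂ)), ?_, ⟨s, ?_⟩, fun i => ?_, fun A hA i v hv => ?_⟩
  · dsimp only
    rw [LieModule.lowerCentralSeries_zero, LieSubmodule.top_toSubmodule]
  · dsimp only
    rw [hs, LieSubmodule.bot_toSubmodule]
  · dsimp only
    exact (LieSubmodule.toSubmodule_le_toSubmodule _ _).mpr
      (LieModule.antitone_lowerCentralSeries ℂ L (Fin b → ℂ) (Nat.le_succ i))
  · -- `A v = ⁅x, v⁆ ∈ ⁅⊤, F_i⁆ = F_{i+1}` for `x = φ A ∈ L`
    let x : L := ⟨φ A, hNmem A hA⟩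
    have hv' : v ∈ LieModule.lowerCentralSeries ℂ L (Fin b → ℂ) i := (LieSubmodule.mem_toSubmodule _).mp hv
    have h := LieSubmodule.lie_mem_lie (LieSubmodule.mem_top x : x ∈ (⊤ : LieIdeal ℂ L)) hv'
    rw [← LieModule.lowerCentralSeries_succ] at h
    have e : ⁅x, v⁆ = A *ᵥ v := by
      rw [LieSubalgebra.coe_bracket_of_module, Module.End.lie_apply]
      exact Matrix.toLinAlgEquiv'_apply A v
    rw [e] at h
    exact (LieSubmodule.mem_toSubmodule _).mpr h

/-! ## §3 Simultaneous strict triangularisation -/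

/-- Diagonal entries of powers of an upper triangular matrix: `(T^k)_{ii} = T_{ii}^k`. -/
theorem pow_apply_self_of_blockTriangular {T : Matrix (Fin b) (Fin b) ℂ} (hT : T.BlockTriangular id) (i : Fin b) :
    ∀ k : ℕ, (T ^ k) i i = T i i ^ k
  | 0 => by simp
  | k + 1 => by
    rw [pow_succ, Literature.LinearAlgebra.Matrix.mul_apply_self_of_blockTriangular (hT.pow k) hT i,
      pow_apply_self_of_blockTriangular hT i k, pow_succ]

/-- A nilpotent upper triangular matrix is STRICTLY upper triangular. -/
theorem apply_eq_zero_of_blockTriangular_of_isNilpotent {T : Matrix (Fin b) (Fin b) ℂ} (hT : T.BlockTriangular id)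
    (hnil : IsNilpotent T) {i j : Fin b} (hji : j ≤ i) : T i j = 0 := by
  rcases lt_or_eq_of_le hji with hlt | heq
  · exact hT hlt
  · subst heq
    obtain ⟨k, hk⟩ := hnil
    have h := pow_apply_self_of_blockTriangular hT j k
    rw [hk, Matrix.zero_apply] at h
    by_contra hne
    exact pow_ne_zero k hne h.symm

/-- ★★★ **ENGEL–McCOY: a Lie-closed nil space is simultaneously strictly upper triangularisable.**  If `V ≤ M_b(ℂ)` consists of nilpotent
matrices and is closed under `[A, B] = AB − BA`, one unit `P` makes EVERY `P A P⁻¹`, `A ∈ V`, strictly upper triangular.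
[cite: HornJohnson2013, Thm. 2.4.8.7 + Thm. 2.4.8.6 (p0162)] -/
theorem exists_unit_conj_strictUpper_of_lieClosed (V : Submodule ℂ (Matrix (Fin b) (Fin b) ℂ)) (hnil : ∀ A ∈ V, IsNilpotent A)
    (hlie : ∀ A ∈ V, ∀ B ∈ V, A * B - B * A ∈ V) :
    ∃ P : (Matrix (Fin b) (Fin b) ℂ)ˣ, ∀ A ∈ V, ∀ i j : Fin b, j ≤ i →
      ((P : Matrix (Fin b) (Fin b) ℂ) * A * (↑P⁻¹ : Matrix (Fin b) (Fin b) ℂ)) i j = 0 := by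
  obtain ⟨F, hF0, ⟨s, hFs⟩, hanti, hlow⟩ := exists_flag_of_lieClosed V hnil hlie
  -- McCoy (a) for the family of all members of `V`
  set fam : V → Matrix (Fin b) (Fin b) ℂ := fun k => (k : Matrix (Fin b) (Fin b) ℂ) with hfam
  have hMcCoy : ∀ (p : FreeAlgebra ℂ V) (k l : V), IsNilpotent (FreeAlgebra.lift ℂ fam p * (fam k * fam l - fam l * fam k)) :=
    fun p k l => isNilpotent_lift_mul_comm_of_lowers F hF0 hFs hanti fam (fun k => hlow k.1 k.2) k l
      (hlow _ (hlie k.1 k.2 l.1 l.2)) p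
  obtain ⟨S, hS, htri⟩ :=
    (Literature.LinearAlgebra.Matrix.SimultaneousTriangularization.forall_isNilpotent_iff_exists_isUnit fam).mp hMcCoy
  obtain ⟨u, hu⟩ := hS
  have hSdet : IsUnit S.det := (Matrix.isUnit_iff_isUnit_det S).mp ⟨u, hu⟩
  refine ⟨u⁻¹, fun A hA i j hji => ?_⟩
  have hP : ((u⁻¹ : (Matrix (Fin b) (Fin b) ℂ)ˣ) : Matrix (Fin b) (Fin b) ℂ) = S⁻¹ := by
    rw [Matrix.coe_units_inv, hu]
  have hPinv : ((u⁻¹⁻¹ : (Matrix (Fin b) (Fin b) ℂ)ˣ) : Matrix (Fin b) (Fin b) ℂ) = S := by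
    rw [inv_inv, hu]
  rw [hP, hPinv]
  -- `S⁻¹ A S` is upper triangular (McCoy) and nilpotent (a conjugate of `A`)
  have hT : (S⁻¹ * A * S).BlockTriangular id := htri ⟨A, hA⟩
  have hpow : ∀ k : ℕ, (S⁻¹ * A * S) ^ k = S⁻¹ * A ^ k * S := by
    intro k
    induction k with
    | zero => rw [pow_zero, pow_zero, Matrix.mul_one, Matrix.nonsing_inv_mul S hSdet]
    | succ k ih =>
      rw [pow_succ, ih, pow_succ]
      calc S⁻¹ * A ^ k * S * (S⁻¹ * A * S) = S⁻¹ * A ^ k * (S * S⁻¹) * A * S := by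
            simp only [Matrix.mul_assoc]
        _ = S⁻¹ * (A ^ k * A) * S := by rw [Matrix.mul_nonsing_inv S hSdet, Matrix.mul_one, Matrix.mul_assoc S⁻¹]
  have hTnil : IsNilpotent (S⁻¹ * A * S) := by
    obtain ⟨k, hk⟩ := hnil A hA
    exact ⟨k, by rw [hpow, hk, Matrix.mul_zero, Matrix.zero_mul]⟩
  exact apply_eq_zero_of_blockTriangular_of_isNilpotent hT hTnil hji

/-- **Nil ALGEBRAS** (closed under products) are Lie-closed, hence simultaneously strictly upper triangularisable. [folklore] -/
theorem exists_unit_conj_strictUpper_of_mulClosed (V : Submodule ℂ (Matrix (Fin b) (Fin b) ℂ)) (hnil : ∀ A ∈ V, IsNilpotent A)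
    (hmul : ∀ A ∈ V, ∀ B ∈ V, A * B ∈ V) :
    ∃ P : (Matrix (Fin b) (Fin b) ℂ)ˣ, ∀ A ∈ V, ∀ i j : Fin b, j ≤ i →
      ((P : Matrix (Fin b) (Fin b) ℂ) * A * (↑P⁻¹ : Matrix (Fin b) (Fin b) ℂ)) i j = 0 :=
  exists_unit_conj_strictUpper_of_lieClosed V hnil fun A hA B hB => V.sub_mem (hmul A hA B hB) (hmul B hB A hA)

/-- **COMMUTATIVE nil spaces** are Lie-closed, hence simultaneously strictly upper triangularisable. [folklore] -/
theorem exists_unit_conj_strictUpper_of_commute (V : Submodule ℂ (Matrix (Fin b) (Fin b) ℂ)) (hnil : ∀ A ∈ V, IsNilpotent A)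
    (hcomm : ∀ A ∈ V, ∀ B ∈ V, A * B = B * A) :
    ∃ P : (Matrix (Fin b) (Fin b) ℂ)ˣ, ∀ A ∈ V, ∀ i j : Fin b, j ≤ i →
      ((P : Matrix (Fin b) (Fin b) ℂ) * A * (↑P⁻¹ : Matrix (Fin b) (Fin b) ℂ)) i j = 0 :=
  exists_unit_conj_strictUpper_of_lieClosed V hnil fun A hA B hB => by
    rw [hcomm A hA B hB, sub_self]; exact V.zero_mem

/-! ## §4 THE ENGEL ROW: (c)'s conclusion with `c = 3` on pencils with values in a Lie-closed nil space -/

variable {n m : ℕ}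

/-- ★★ **THE ENGEL ROW.**  An affine pencil `N` all of whose values `N(x)` lie in a linear space `V ≤ M_m(ℂ)` of nilpotent matrices closed under
the commutator has `RelCert n m N (3·(⌊√n⌋·m))` — (c)'s conclusion with `c = 3`, `n₀ = 0` (Engel–McCoy + ✓ `relCert_of_valueSpace_triangularisable`).
[cite: HornJohnson2013, Thm. 2.4.8.7 (p0162)] -/
theorem relCert_of_valueSpace_lieClosed (N : AffMat n m) (hN : IsAffine N)
    (V : Submodule ℂ (Matrix (Fin m) (Fin m) ℂ)) (hV : ∀ x : Fin n × Fin n → ℂ, N.map (MvPolynomial.eval x) ∈ V)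
    (hnil : ∀ A ∈ V, IsNilpotent A) (hlie : ∀ A ∈ V, ∀ B ∈ V, A * B - B * A ∈ V) :
    RelCert n m N (3 * (Nat.sqrt n * m)) := by
  obtain ⟨P, hP⟩ := exists_unit_conj_strictUpper_of_lieClosed V hnil hlie
  exact relCert_of_valueSpace_triangularisable N hN V hV P hP

/-- **The Engel row for nil algebras** (value space closed under products). [folklore] -/
theorem relCert_of_valueSpace_mulClosed (N : AffMat n m) (hN : IsAffine N)
    (V : Submodule ℂ (Matrix (Fin m) (Fin m) ℂ)) (hV : ∀ x : Fin n × Fin n → ℂ, N.map (MvPolynomial.eval x) ∈ V)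
    (hnil : ∀ A ∈ V, IsNilpotent A) (hmul : ∀ A ∈ V, ∀ B ∈ V, A * B ∈ V) :
    RelCert n m N (3 * (Nat.sqrt n * m)) := by
  obtain ⟨P, hP⟩ := exists_unit_conj_strictUpper_of_mulClosed V hnil hmul
  exact relCert_of_valueSpace_triangularisable N hN V hV P hP

/-- **The Engel row for commutative value spaces.** [folklore] -/
theorem relCert_of_valueSpace_commute (N : AffMat n m) (hN : IsAffine N)
    (V : Submodule ℂ (Matrix (Fin m) (Fin m) ℂ)) (hV : ∀ x : Fin n × Fin n → ℂ, N.map (MvPolynomial.eval x) ∈ V)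
    (hnil : ∀ A ∈ V, IsNilpotent A) (hcomm : ∀ A ∈ V, ∀ B ∈ V, A * B = B * A) :
    RelCert n m N (3 * (Nat.sqrt n * m)) := by
  obtain ⟨P, hP⟩ := exists_unit_conj_strictUpper_of_commute V hnil hcomm
  exact relCert_of_valueSpace_triangularisable N hN V hV P hP

/-- ★ **(c) ON THE LIE-CLOSED LOCUS**, in the binder shape of the stub `SlowCore.LongMassSlowLawInv` with `c = 3`, `n₀ = 0`: the hypotheses
`B ^ b = 0` / `IrreducibleInv B` replaced by «the values of `B` lie in a Lie-closed space of nilpotent matrices» (NOT an instance of the stub: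
an irreducible constituent of size `b ≥ 2` is never triangularisable — ✓ `NilSpaceSandwichIrr`). [cite: HornJohnson2013, Thm. 2.4.8.7 (p0162)] -/
theorem longMass_on_lieClosed_locus :
    ∀ n b : ℕ, ∀ B : AffMat n b, IsAffine B →
      (∃ V : Submodule ℂ (Matrix (Fin b) (Fin b) ℂ), (∀ x : Fin n × Fin n → ℂ, B.map (MvPolynomial.eval x) ∈ V) ∧
        (∀ A ∈ V, IsNilpotent A) ∧ (∀ A ∈ V, ∀ A' ∈ V, A * A' - A' * A ∈ V)) →
      RelCert n b B (3 * (Nat.sqrt n * b)) := by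
  intro n b B hB hV
  obtain ⟨V, hV, hnil, hlie⟩ := hV
  exact relCert_of_valueSpace_lieClosed B hB V hV hnil hlie

end Summit.ValiantsHypothesis.ValiantsHypothesis.Theorems.GrenetZeon.NilSpaceEngel

end
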